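import Literature.MathematicalPhysics.QuantumFieldTheory.Balaban1983to89.B12Ineq39
import Literature.MathematicalPhysics.QuantumFieldTheory.Balaban1983to89.B11Ineq190Actual

/-!
# `Balaban1983to89.B12Ineq39From190` — T. Bałaban, *Renormalization group approach to lattice gauge field theories. I*,
# Commun. Math. Phys. **109** (1987) 249–301 [Balaban1987RG1] = [I], §3 p. 271: the far-term bound **(3.9)** FOR THE ACTUAL
# FRÉCHET DERIVATIVE `(δ/δB)𝐇_j` OF THE [15] (179) CHART — the located hypothesis `h190` of `B12Ineq39.ineq39_of_ineq190`
# SUPPLIED BY NAME from [15] = [Balaban1985Variational] Prop. 9 / (190) as assembled in `B11Ineq190Actual` (r08), at scheme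
# level, on any size-nonincreasing presentation (p29 `B11Presentation190`), uniformly on the domain of (180), and for the clause
# *«and the same for derivatives and the second order operators applied to it»* (entries n = 2, 3, 4 of (190))

statement-level skeleton of published theorems with citation tags; proofs where landed; nothing here is a claim
about the Yang–Mills mass gap

CITATION HEADER (lean-in-tree rule 2026-08-18).  T. Bałaban, *Renormalization group approach to lattice gauge field theories.
I. Generation of effective actions in a small field approximation and a coupling constant renormalization in four dimensions*,
Commun. Math. Phys. **109**, 249–301 (1987), doi:10.1007/BF01215223, bib `Balaban1987RG1` (cell paper B12 = "[I]"; PDF held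
`paper:balaban1987-cmp109-rg-i-small-field`, p. 271 = PDF 23, render `b2b-balaban-ref1/pages/1987-cmp109-rg-I-small-field/
…-p023-x2.png`, re-read as an image by this seat 2026-08-22).  "[15]" = T. Bałaban, *The variational problem and background fields in
renormalization group method for lattice gauge theories*, Commun. Math. Phys. **102**, 277–309 (1985), bib `Balaban1985Variational`
(cell paper B11; Prop. 9 p. 309, (190) p. 308, (179)–(180) p. 306, (189) p. 308).  "[3]" of [15] = T. Bałaban, *Propagators and
renormalization transformations for lattice gauge theories. II*, Commun. Math. Phys. **96** (1984) 223–250, bib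
`Balaban1984PropagatorsII` (Lemma 2.1 (2.61) p. 234, (2.54) p. 233).  Mega-formalization `lit-balaban`, HOME
`run/shared/lean/pub/lit-balaban/`, unit `lit-balaban-r20` gen 13 (B12 fold owner).

WHAT IS REPRODUCED.  SKELETON row **B12.Eq3.9** (display owner r09, fold owner r20; decls of record `B12Ineq39.Ineq39Printed`,
`loc_dH_le_39`, `ineq39_of_ineq190`).  THE PRINT, p. 271 [PDF 23], verbatim: *"The derivative (δ/δB)𝐇_j is an exponentially
decaying function, with the decay rate δ₀ on the ξ-scale, see Proposition 9, (190) [15]. Let us denote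
  δ𝐇_j = ⟨((δ/δB)𝐇_j)(B(t)), ⟨((δ/δ𝐀)Q_j)(ηt𝐇_k(B′)), L^jη ζ_□𝐇_k(B′)⟩⟩.   (3.8)
In the case when dist^{(ξ)}(X, □) ≥ M(L^jη)^{−1}, this function satisfies the bound
  |δ𝐇_j| ≤ B₃ exp(−½δ₀ dist^{(ξ)}(X, □) − ½δ₀M(L^jη)^{−1}) × 2L^jη|ζ_□𝐇_k(B′)|  on X,   (3.9)
and the same for derivatives and the second order operators applied to it."*  [15] (190) p. 308: *"|(δ/δB_ν(y′))𝓗_μ(B,x)|,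
|∇_x(δ/δB_ν(y′))𝓗_μ(B,x)|, ‖ζ∇(δ/δB(y′))𝓗(B)‖_β, |D^{η*}_{U_k}D^η_{U_k}(δ/δB_ν(y))𝓗_μ(B,x)|, |Δ^η_{U_k}(δ/δB_ν(y′))𝓗_μ(B,x)|
≦ O(1)[…]·(L^{j′}η)^{−d} exp(−⅛δ₀d(y,y′)) (190) for x ∈ Δ(y), … y ∈ Λ_j, y′ ∈ Λ_{j′}."*; Prop. 9 p. 309: *"The function 𝓗(B)
is determined by Eqs. (174), (175) … It is an analytic function of B … and its functional derivative (182) satisfies the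
inequalities (190)."*  (Reading of record, INTERFACES §3 NEED-3(b) v1.14 / P-R2-6, concurred r08 g5 + r20 g5: [I] (3.26)–(3.27)'s
𝐇_{k+1}(□₀,·) — and here 𝐇_j of (3.6) — IS the ℋ of [15] (174)/(179) for the localised variational problem, [15]'s η instantiated
at the ξ-scale; one object.)

THE CHAIN, BY NAME (nothing restated, nothing modified).  The cell's surge node `B12Ineq39` (pub-balaban pv12) proves (3.9) from the
(190) record in the block vocabulary of `B11SectG`: `ineq39_of_ineq190` takes `h190 : Ineq190 bB bout dH C δ₀` for an ABSTRACT
ℝ-linear `dH`, one row sum `RowSum g σ c` ([3] (2.61)), the printed size `2L^jη|ζ_□𝐇_k(B′)|` of the (3.8)-field `δB` (`hm`), its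
localisation in □ (`hD`) and the case `M(L^jη)^{−1} ≤ dist^{(ξ)}(X, □)` (`hcase`).  r08 g10's `B11Ineq190Actual.ineq190_sectG` /
`ineq190_strong_sectG` / `ineq190_sectG_dom` PRODUCE `Ineq190 bB bN ((δ/δB)𝓗(B)) const190 δ₀` for the ACTUAL Fréchet derivative
`fderiv ℂ (chartH179 𝒢 W D2 H₀ (· − H(D ·)) ε₄) B` of the (179) chart at every point `B` of the domain of (180), from the located
leaves of [15] Sect. G only; p29 g9's `B11Presentation190.ineq190_postcomp_of_loc_le` transports (190) along any size-nonincreasing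
linear presentation.  THIS FILE COMPOSES them, so that in (3.9) the (190) record ITSELF is no longer a hypothesis: `dH` IS
`((δ/δB)𝐇_j)(B(t))` for `B(t)` a point of the domain.  The B12 member of the cell's (190)-knitting family (r11 `B14From190SectG`,
r12 `B15From190SectG`, p29 `B16Ineq123From190` §4).

WHAT THIS FILE PROVES (kernel-checked, zero `sorry`; theorems only — no `def`, no new `Prop`, no named fact; axioms standard).
§1 `ineq39_sectG` — (3.9) `Ineq39Printed P` AT SCHEME LEVEL: `P.lhs = bN.loc y (((δ/δB)𝓗)(B(t)) δB)` for `y ∈ X`, `bN` the N-size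
   of [15] (115)/(190) on the configuration space `𝒴` (entries n = 0, 1 of (190)), `B₃^{(3.9)} = const190·κ_B·c`,
   `δ₀^{(3.9)} = τ` for any `τ ≥ 0` with `σ + τ ≤ ⅛δ₀^{[15]}` (GAPS G-IF-06: the [I]-rate strictly below ⅛δ₀^{[15]}; the ONE row sum
   `RowSum g σ c` is fed to r08 at the rate ⅛δ₀ by `RowSum.mono`);
   `ineq39_sectG_dom` — the same UNIFORMLY for every point `B(t)` of the domain of (180) (print: (3.8) at `B(t) = Q_j(ηt𝐇_k(B′))`,
   `t ∈ [0,1]`; the located side condition that this curve stays in the domain is the consumer's, (3.1)/(3.3)).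
§2 `ineq39_sectG_strong` — *«and the same for derivatives and the second order operators applied to it»*: (3.9) with `P.lhs` the
   SECOND local size `bN₂` of `δ𝐇_j` (entries n = 2, 3, 4 of (190): ∇, the Hölder norm, D^*D, Δ), `∃ B₃ ≥ 0`, from r08's
   `ineq190_strong_sectG` (the additional located majorants of G̃, H₀, H INTO `bN₂`: [15] p. 306, (130), (137)–(139)).
§3 `ineq39_sectG_presentation` / `ineq39_sectG_supSize` — (3.9) ON A PRESENTED SPACE: for any ℝ-linear presentation
   `Pr : 𝒴 →ₗ[ℝ] F₃` not increasing the sizes (`b₃.loc y (Pr v) ≤ bN.loc y v`), in particular the lattice presentation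
   `x ↦ ev x` into `X → E` with r11's sup size `B11SupSize190.supSize g box blk` (*"for x ∈ Δ(y)"*, compatibility letter `hev`),
   `P.lhs = b₃.loc y (Pr (((δ/δB)𝓗)(B(t)) δB))` obeys (3.9) with the SAME constants.
HONEST SCOPE.  Assembly of landed theorems BY NAME: pv12 `B12Ineq39` (via `B12Ineq45.loc_dH_le_of_ineq190_localised`), r08
`B11Ineq190Actual` (p304614), p29 `B11Presentation190` (p303950), r08 `B11SectG`/`B11Eq183Differentiation`.  What is LEFT as
hypothesis in every theorem here, exactly: (i) r08's located leaves of [15] Sect. G — the regime (117)–(121)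
`Regime 𝒢 0 W B₀ θ C₄ a₃ j a ε₄`, `W = (δ/δA′)V` analytic on `‖Y‖ < a₃`, the Sect. C map `D` differentiable at `𝒜₀(B) + H₀B` with
(73)-majorant `θ_𝔇e^{−½δ₀d}` of its derivative (`hD`/`hDfr`), the point `B(t)` in the domain of (180) (`‖H₀B‖ < a ∧ ‖Δ⁽²⁾H₀B‖ < j`),
(189) `h189` there (G-B11-G2, *«We do not perform these calculations here»*), the kernel letters of G̃ (`hG`), Δ⁽²⁾H₀ (`hD2H0`), H₀
(`hH0`), H (`hH`), [3] (2.54) `htri`/`hd`, the smallness `q < 1` of (187) (`hq`), the size↔norm compatibility letters `hN`, `hBloc`;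
(ii) the knit's own located side conditions verbatim from `B12Ineq39` — ONE row sum [3] (2.61) `RowSum g σ c` with `τ ≥ 0`,
`σ + τ ≤ ⅛δ₀`, the weight `const190·κ_B·c` of (190)'s explicit constant against print's `B₃` (`hB₃`), the (3.8)-field letters `hm`
(its B-sizes `≤ 2L^jη|ζ_□𝐇_k(B′)|` — the factor 2 is a bound of `(δ/δ𝐀)Q_j`, [12] Prop. 5, not displayed in [I]), `hloc` (δB localised
in □ at ξ-distance `≥ dist^{(ξ)}(X, □)` from X) and `hcase` (`M(L^jη)^{−1} ≤ dist^{(ξ)}(X, □)`, the case of (3.5)); (iii) in §3 the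
presentation letter `hPr`/`hev`.  The words *«and finally Proposition 2 and (181)»* of [15] p. 308 (transport from the base point,
G-B11-G2a) are not typed, as in `B11SectG`.  No lattice object of [15] is constructed (the instantiation of `𝒴` as the space (115) is
the presentation datum); the bound for (3.7) (*«easily», analyticity of 𝐄^{(j)}*) and the second case of (3.5) are not here (rows
B12.Eq3.5-3.7, `B12FarTerms36`).  NOT summit progress.  r20 gen 13 (literature-prover-lit-balaban-r20-g13-0).
v1.0.1 (r20 gen 14, DOCSTRING-ONLY): citation locator of [15] display (115) corrected p. 295 → p. 294 (CMP 102 p. 294 = PDF 18, last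
display of the page; (117) opens p. 295) at `ineq39_presentation` / `ineq39_supSize` — CITELOC relayed by r12 g14 from r08's map;
declarations byte-identical.
-/

noncomputable section

namespace Literature.MathematicalPhysics.QuantumFieldTheory.Balaban1983to89.B12Ineq39From190

open Literature.MathematicalPhysics.QuantumFieldTheory.Balaban1983to89
open B11SectG B11Eq174Chart B11Eq183Differentiation B11Presentation190 B11SupSize190 B11Ineq190Actual B12Ineq39
  B6RandomWalk Set Metric

/-- The (190) constant `const190 κ_B κ_N κ₃ B_G θ_W c_Δ A₀ A_H θ_𝔇 c` of `B11SectG` is `≥ 0` for non-negative data under the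
smallness `q < 1` of (187) (as p29's `B16Ineq123From190.const190_nonneg` / r11's private copy; re-proved here to keep the import
cone inside B11/B12). [cite: Balaban1985Variational, (187)–(190) p.308] -/
private theorem const190_nonneg' {κB κN κ₃ BG θW cΔ A₀ AH θD c : ℝ} (hκB : 0 ≤ κB) (hκN : 0 ≤ κN) (hκ₃ : 0 ≤ κ₃)
    (hc : 0 ≤ c) (hBG : 0 ≤ BG) (hθW : 0 ≤ θW) (hcΔ : 0 ≤ cΔ) (hA₀ : 0 ≤ A₀) (hAH : 0 ≤ AH) (hθD : 0 ≤ θD)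
    (hq : qG κ₃ κN BG θW c < 1) : 0 ≤ const190 κB κN κ₃ BG θW cΔ A₀ AH θD c := by
  unfold const190
  have h₁ := constA0_nonneg (cΔ := cΔ) hκ₃ hκN hBG hθW hcΔ hA₀ hc hq
  positivity

variable {𝒳 𝒴 𝒵 : Type} [NormedAddCommGroup 𝒳] [NormedSpace ℂ 𝒳] [NormedAddCommGroup 𝒴] [NormedSpace ℂ 𝒴]
  [NormedAddCommGroup 𝒵] [NormedSpace ℂ 𝒵] [CompleteSpace 𝒳] [CompleteSpace 𝒴] [CompleteSpace 𝒵]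
  {𝒢 : 𝒵 →L[ℂ] 𝒴} {W : 𝒴 → 𝒵} {D2 : 𝒴 →L[ℂ] 𝒵} {H₀ : 𝒳 →L[ℂ] 𝒴} {B₀ θ C₄ a₃ j a ε₄ : ℝ}
  {g : B6.Geometry}

/-! ## §1 (3.9) at scheme level, for the actual derivative `((δ/δB)𝐇_j)(B(t))` -/

/-- **(3.9) FOR THE ACTUAL DERIVATIVE, scheme level.**  Let `𝓗 = chartH179 𝒢 W D2 H₀ (· − H(D ·)) ε₄` be the [15] (179) chart
(= [I]'s 𝐇_j of (3.6), reading P-R2-6) and `Bt` a point of the domain of (180) (print's `B(t)`).  Under r08's located leaves of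
[15] Sect. G (so that (190) HOLDS for `D𝓗(Bt)`, `B11Ineq190Actual.ineq190_sectG`), ONE row sum `RowSum g σ c` ([3] (2.61)) and
the (3.8)-field letters — `δB` has B-sizes `≤ 2L^jη|ζ_□𝐇_k(B′)|` (`hm`), is localised in □ at ξ-distance `≥ dist^{(ξ)}(X,□)` from
`X` (`hloc`), and `M(L^jη)^{−1} ≤ dist^{(ξ)}(X,□)` (`hcase`) — the display (3.9) `Ineq39Printed P` holds at every block `y ∈ X`
with `P.lhs = bN.loc y (D𝓗(Bt) δB)` (the N-size of `δ𝐇_j` near `y`, entries n = 0, 1 of (190)), `P.B₃ = const190·κ_B·c` and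
`P.δ₀ = τ`, any `τ ≥ 0` with `σ + τ ≤ ⅛δ₀^{[15]}`.  Proof: `B12Ineq39.ineq39_of_ineq190` ∘ `B11Ineq190Actual.ineq190_sectG`.
[cite: Balaban1987RG1, (3.8)–(3.9) p.271] [cite: Balaban1985Variational, Prop. 9 (190) pp.308–309]
[cite: Balaban1984PropagatorsII, Lemma 2.1 (2.61) p.234] -/
theorem ineq39_sectG (R : Regime 𝒢 0 W B₀ θ C₄ a₃ j a ε₄) (hWa : AnalyticOnNhd ℂ W {Y : 𝒴 | ‖Y‖ < a₃})
    {Bt : 𝒳} (hJ : ‖D2 (H₀ Bt)‖ < j) (h𝔄 : ‖H₀ Bt‖ < a) {D : 𝒴 → 𝒳} {𝔇 : 𝒴 →L[ℂ] 𝒳} (H : 𝒳 →L[ℂ] 𝒴)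
    (hD : HasFDerivAt D 𝔇 (solA180 𝒢 W D2 H₀ ε₄ Bt + H₀ Bt))
    {bB : BlockNorm g 𝒳} {bN : BlockNorm g 𝒴} {b3 : BlockNorm g 𝒵}
    (hN : ∀ (y : g.Site) (v : 𝒴), bN.loc y v ≤ ‖v‖) (hBloc : ∀ (y' : g.Site) (μ : 𝒳), bB.IsLoc y' μ → ‖μ‖ ≤ bB.loc y' μ)
    {δ₀ BG θW cΔ A₀ AH θD c σ : ℝ}
    (htri : Triangle254 g) (hd : ∀ a b : g.Site, 0 ≤ g.dist a b) (hδ₀ : 0 ≤ δ₀) (hrow : RowSum g σ c)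
    (hBG : 0 ≤ BG) (hθW : 0 ≤ θW) (hcΔ : 0 ≤ cΔ) (hA₀ : 0 ≤ A₀) (hAH : 0 ≤ AH) (hθD : 0 ≤ θD)
    (hG : HasMaj b3 bN (𝒢.restrictScalars ℝ : 𝒵 →ₗ[ℝ] 𝒴) (fun y y' => BG * Real.exp (-(δ₀ * g.dist y y'))))
    (h189 : Ineq189 bN b3 ((fderiv ℂ W (solA180 𝒢 W D2 H₀ ε₄ Bt + H₀ Bt)).restrictScalars ℝ : 𝒴 →ₗ[ℝ] 𝒵) θW δ₀)
    (hD2H0 : HasMaj bB b3 ((D2 ∘L H₀).restrictScalars ℝ : 𝒳 →ₗ[ℝ] 𝒵) (fun y y' => cΔ * Real.exp (-(δ₀ * g.dist y y'))))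
    (hH0 : HasMaj bB bN (H₀.restrictScalars ℝ : 𝒳 →ₗ[ℝ] 𝒴) (fun y y' => A₀ * Real.exp (-(δ₀ * g.dist y y'))))
    (hH : HasMaj bB bN (H.restrictScalars ℝ : 𝒳 →ₗ[ℝ] 𝒴) (fun y y' => AH * Real.exp (-(δ₀ / 2 * g.dist y y'))))
    (hDfr : HasMaj bN bB (𝔇.restrictScalars ℝ : 𝒴 →ₗ[ℝ] 𝒳) (fun y y' => θD * Real.exp (-(δ₀ / 2 * g.dist y y'))))
    (hq : qG b3.κ bN.κ BG θW c < 1)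
    (P : Data39) (hτ : 0 ≤ P.δ₀) (hστ : σ + P.δ₀ ≤ δ₀ / 8)
    (hB₃ : P.B₃ = const190 bB.κ bN.κ b3.κ BG θW cΔ A₀ AH θD c * bB.κ * c)
    (δB : 𝒳) (hm : ∀ y', bB.loc y' δB ≤ 2 * P.Ljη * P.normZH) (X : Set g.Site)
    (hloc : ∀ y ∈ X, ∀ y', bB.loc y' δB ≠ 0 → P.distX ≤ g.dist y y') (hcase : P.Minv ≤ P.distX)
    {y : g.Site} (hy : y ∈ X)
    (hlhs : P.lhs = bN.loc y (fderiv ℂ (chartH179 𝒢 W D2 H₀ (fun Y : 𝒴 => Y - H (D Y)) ε₄) Bt δB)) :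
    Ineq39Printed P := by
  have hc : 0 ≤ c := hrow.nonneg y
  have hσ : σ ≤ δ₀ / 8 := by linarith
  have h190 := ineq190_sectG R hWa hJ h𝔄 H hD hN hBloc htri hd hδ₀ (hrow.mono hd hσ) hc hBG hθW hcΔ hA₀ hAH hθD hG
    h189 hD2H0 hH0 hH hDfr hq
  exact ineq39_of_ineq190 P h190
    (const190_nonneg' bB.κ_nonneg bN.κ_nonneg b3.κ_nonneg hc hBG hθW hcΔ hA₀ hAH hθD hq)
    hd hrow hτ hστ hB₃ δB hm X hloc hcase hy (by simpa using hlhs)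

/-- **(3.9) FOR THE ACTUAL DERIVATIVE, UNIFORMLY ON THE DOMAIN OF (180).**  Print evaluates `(δ/δB)𝐇_j` at `B(t) =
Q_j(ηt𝐇_k(B′))`, `t ∈ [0,1]` ((3.8)); with (189) and (73) assumed at every point of the domain with uniform letters (print:
*«for A′ satisfying (77)»*, r08's `ineq190_sectG_dom`), (3.9) holds with ONE pair `(B₃, δ₀^{(3.9)})` at EVERY point `Bt` of the
domain — in particular along any curve `t ↦ B(t)` staying in it (the consumer's located side condition, (3.1)/(3.3)).
[cite: Balaban1987RG1, (3.8)–(3.9) p.271] [cite: Balaban1985Variational, (189)–(190) p.308, (77) p.290] -/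
theorem ineq39_sectG_dom (R : Regime 𝒢 0 W B₀ θ C₄ a₃ j a ε₄) (hWa : AnalyticOnNhd ℂ W {Y : 𝒴 | ‖Y‖ < a₃})
    {D : 𝒴 → 𝒳} (H : 𝒳 →L[ℂ] 𝒴)
    {bB : BlockNorm g 𝒳} {bN : BlockNorm g 𝒴} {b3 : BlockNorm g 𝒵}
    (hN : ∀ (y : g.Site) (v : 𝒴), bN.loc y v ≤ ‖v‖) (hBloc : ∀ (y' : g.Site) (μ : 𝒳), bB.IsLoc y' μ → ‖μ‖ ≤ bB.loc y' μ)
    {δ₀ BG θW cΔ A₀ AH θD c σ : ℝ}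
    (htri : Triangle254 g) (hd : ∀ a b : g.Site, 0 ≤ g.dist a b) (hδ₀ : 0 ≤ δ₀) (hrow : RowSum g σ c)
    (hBG : 0 ≤ BG) (hθW : 0 ≤ θW) (hcΔ : 0 ≤ cΔ) (hA₀ : 0 ≤ A₀) (hAH : 0 ≤ AH) (hθD : 0 ≤ θD)
    (hG : HasMaj b3 bN (𝒢.restrictScalars ℝ : 𝒵 →ₗ[ℝ] 𝒴) (fun y y' => BG * Real.exp (-(δ₀ * g.dist y y'))))
    (hD2H0 : HasMaj bB b3 ((D2 ∘L H₀).restrictScalars ℝ : 𝒳 →ₗ[ℝ] 𝒵) (fun y y' => cΔ * Real.exp (-(δ₀ * g.dist y y'))))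
    (hH0 : HasMaj bB bN (H₀.restrictScalars ℝ : 𝒳 →ₗ[ℝ] 𝒴) (fun y y' => A₀ * Real.exp (-(δ₀ * g.dist y y'))))
    (hH : HasMaj bB bN (H.restrictScalars ℝ : 𝒳 →ₗ[ℝ] 𝒴) (fun y y' => AH * Real.exp (-(δ₀ / 2 * g.dist y y'))))
    (h189 : ∀ B' : 𝒳, ‖H₀ B'‖ < a → ‖D2 (H₀ B')‖ < j →
      Ineq189 bN b3 ((fderiv ℂ W (solA180 𝒢 W D2 H₀ ε₄ B' + H₀ B')).restrictScalars ℝ : 𝒴 →ₗ[ℝ] 𝒵) θW δ₀)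
    (hDfr : ∀ B' : 𝒳, ‖H₀ B'‖ < a → ‖D2 (H₀ B')‖ < j →
      ∃ 𝔇 : 𝒴 →L[ℂ] 𝒳, HasFDerivAt D 𝔇 (solA180 𝒢 W D2 H₀ ε₄ B' + H₀ B') ∧
        HasMaj bN bB (𝔇.restrictScalars ℝ : 𝒴 →ₗ[ℝ] 𝒳) (fun y y' => θD * Real.exp (-(δ₀ / 2 * g.dist y y'))))
    (hq : qG b3.κ bN.κ BG θW c < 1)
    {τ : ℝ} (hτ : 0 ≤ τ) (hστ : σ + τ ≤ δ₀ / 8)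
    (δB : 𝒳) {m : ℝ} (hm : ∀ y', bB.loc y' δB ≤ m) (X : Set g.Site) {distX Minv : ℝ}
    (hloc : ∀ y ∈ X, ∀ y', bB.loc y' δB ≠ 0 → distX ≤ g.dist y y') (hcase : Minv ≤ distX) :
    ∀ Bt : 𝒳, ‖H₀ Bt‖ < a → ‖D2 (H₀ Bt)‖ < j → ∀ y ∈ X, ∀ P : Data39,
      P.δ₀ = τ → P.B₃ = const190 bB.κ bN.κ b3.κ BG θW cΔ A₀ AH θD c * bB.κ * c →
      2 * P.Ljη * P.normZH = m → P.distX = distX → P.Minv = Minv →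
      P.lhs = bN.loc y (fderiv ℂ (chartH179 𝒢 W D2 H₀ (fun Y : 𝒴 => Y - H (D Y)) ε₄) Bt δB) →
      Ineq39Printed P := by
  intro Bt h𝔄 hJ y hy P hPτ hPB hPm hPd hPM hlhs
  obtain ⟨𝔇, hD𝔇, h𝔇⟩ := hDfr Bt h𝔄 hJ
  subst hPd hPM
  refine ineq39_sectG R hWa hJ h𝔄 H hD𝔇 hN hBloc htri hd hδ₀ hrow hBG hθW hcΔ hA₀ hAH hθD hG (h189 Bt h𝔄 hJ)
    hD2H0 hH0 hH h𝔇 hq P (hPτ ▸ hτ) (hPτ ▸ hστ) hPB δB (fun y' => (hm y').trans_eq hPm.symm) X hloc hcase hy hlhs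

/-! ## §2 *«and the same for derivatives and the second order operators applied to it»* -/

/-- **(3.9) for the derivatives / second-order operators applied to `δ𝐇_j`** (p. 271: *«and the same for derivatives and the
second order operators applied to it»*): with the additional located majorants of G̃, H₀, H INTO a second local size `bN₂` on `𝒴`
([15] p. 306 *«exactly the same properties as Δ_a⁻¹»*, (130) p. 298, (137)–(139) pp. 298–299 — r08's `ineq190_strong_sectG`,
entries n = 2, 3, 4 of (190)), the display (3.9) holds for `P.lhs = bN₂.loc y (D𝓗(Bt) δB)` with SOME constant `B₃ ≥ 0` (the
existential of `B11SectG.ineq190_strong_of_189`, times `κ_B·c`) and the same rate bookkeeping.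
[cite: Balaban1987RG1, (3.9) p.271] [cite: Balaban1985Variational, (130) p.298, (137)–(139) pp.298–299, (190) p.308] -/
theorem ineq39_sectG_strong (R : Regime 𝒢 0 W B₀ θ C₄ a₃ j a ε₄) (hWa : AnalyticOnNhd ℂ W {Y : 𝒴 | ‖Y‖ < a₃})
    {Bt : 𝒳} (hJ : ‖D2 (H₀ Bt)‖ < j) (h𝔄 : ‖H₀ Bt‖ < a) {D : 𝒴 → 𝒳} {𝔇 : 𝒴 →L[ℂ] 𝒳} (H : 𝒳 →L[ℂ] 𝒴)
    (hD : HasFDerivAt D 𝔇 (solA180 𝒢 W D2 H₀ ε₄ Bt + H₀ Bt))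
    {bB : BlockNorm g 𝒳} {bN bN₂ : BlockNorm g 𝒴} {b3 : BlockNorm g 𝒵}
    (hN : ∀ (y : g.Site) (v : 𝒴), bN.loc y v ≤ ‖v‖) (hBloc : ∀ (y' : g.Site) (μ : 𝒳), bB.IsLoc y' μ → ‖μ‖ ≤ bB.loc y' μ)
    {δ₀ BG BG₂ θW cΔ A₀ A₀₂ AH₂ θD c σ : ℝ}
    (htri : Triangle254 g) (hd : ∀ a b : g.Site, 0 ≤ g.dist a b) (hδ₀ : 0 ≤ δ₀) (hrow : RowSum g σ c)
    (hBG : 0 ≤ BG) (hBG₂ : 0 ≤ BG₂) (hθW : 0 ≤ θW) (hcΔ : 0 ≤ cΔ) (hA₀ : 0 ≤ A₀) (hA₀₂ : 0 ≤ A₀₂)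
    (hAH₂ : 0 ≤ AH₂) (hθD : 0 ≤ θD)
    (hG : HasMaj b3 bN (𝒢.restrictScalars ℝ : 𝒵 →ₗ[ℝ] 𝒴) (fun y y' => BG * Real.exp (-(δ₀ * g.dist y y'))))
    (hG₂ : HasMaj b3 bN₂ (𝒢.restrictScalars ℝ : 𝒵 →ₗ[ℝ] 𝒴) (fun y y' => BG₂ * Real.exp (-(δ₀ * g.dist y y'))))
    (h189 : Ineq189 bN b3 ((fderiv ℂ W (solA180 𝒢 W D2 H₀ ε₄ Bt + H₀ Bt)).restrictScalars ℝ : 𝒴 →ₗ[ℝ] 𝒵) θW δ₀)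
    (hD2H0 : HasMaj bB b3 ((D2 ∘L H₀).restrictScalars ℝ : 𝒳 →ₗ[ℝ] 𝒵) (fun y y' => cΔ * Real.exp (-(δ₀ * g.dist y y'))))
    (hH0 : HasMaj bB bN (H₀.restrictScalars ℝ : 𝒳 →ₗ[ℝ] 𝒴) (fun y y' => A₀ * Real.exp (-(δ₀ * g.dist y y'))))
    (hH0₂ : HasMaj bB bN₂ (H₀.restrictScalars ℝ : 𝒳 →ₗ[ℝ] 𝒴) (fun y y' => A₀₂ * Real.exp (-(δ₀ * g.dist y y'))))
    (hH₂ : HasMaj bB bN₂ (H.restrictScalars ℝ : 𝒳 →ₗ[ℝ] 𝒴) (fun y y' => AH₂ * Real.exp (-(δ₀ / 2 * g.dist y y'))))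
    (hDfr : HasMaj bN bB (𝔇.restrictScalars ℝ : 𝒴 →ₗ[ℝ] 𝒳) (fun y y' => θD * Real.exp (-(δ₀ / 2 * g.dist y y'))))
    (hq : qG b3.κ bN.κ BG θW c < 1)
    (P : Data39) (hτ : 0 ≤ P.δ₀) (hστ : σ + P.δ₀ ≤ δ₀ / 8)
    (δB : 𝒳) (hm : ∀ y', bB.loc y' δB ≤ 2 * P.Ljη * P.normZH) (X : Set g.Site)
    (hloc : ∀ y ∈ X, ∀ y', bB.loc y' δB ≠ 0 → P.distX ≤ g.dist y y') (hcase : P.Minv ≤ P.distX)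
    {y : g.Site} (hy : y ∈ X)
    (hlhs : P.lhs = bN₂.loc y (fderiv ℂ (chartH179 𝒢 W D2 H₀ (fun Y : 𝒴 => Y - H (D Y)) ε₄) Bt δB)) :
    ∃ B₃ : ℝ, 0 ≤ B₃ ∧ Ineq39Printed { P with B₃ := B₃ } := by
  have hc : 0 ≤ c := hrow.nonneg y
  have hσ : σ ≤ δ₀ / 8 := by linarith
  obtain ⟨C, hC, h190⟩ := ineq190_strong_sectG R hWa hJ h𝔄 H hD hN hBloc htri hd hδ₀ (hrow.mono hd hσ) hc hBG hBG₂
    hθW hcΔ hA₀ hA₀₂ hAH₂ hθD hG hG₂ h189 hD2H0 hH0 hH0₂ hH₂ hDfr hq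
  refine ⟨C * bB.κ * c, mul_nonneg (mul_nonneg hC bB.κ_nonneg) hc, ?_⟩
  exact ineq39_of_ineq190 { P with B₃ := C * bB.κ * c } h190 hC hd hrow hτ hστ rfl δB hm X hloc hcase hy
    (by simpa using hlhs)

/-! ## §3 (3.9) on a presented space (any size-nonincreasing presentation; the lattice sup size) -/

section Presentation

variable {F₃ : Type} [AddCommGroup F₃] [Module ℝ F₃]

/-- **(3.9) ON A PRESENTED SPACE.**  For any ℝ-linear presentation `Pr : 𝒴 →ₗ[ℝ] F₃` of the configurations that does not increase
the local sizes (`b₃.loc y (Pr v) ≤ bN.loc y v` — e.g. reading off lattice values, print's (190) sizes being weighted sup norms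
*«for x ∈ Δ(y)»*), (190) for `D𝓗(Bt)` transports to `Pr ∘ D𝓗(Bt)` with the same constant (p29's
`B11Presentation190.ineq190_postcomp_of_loc_le`), hence (3.9) holds for `P.lhs = b₃.loc y (Pr (D𝓗(Bt) δB))` with the SAME
`B₃ = const190·κ_B·c`, `δ₀^{(3.9)} = τ`. [cite: Balaban1987RG1, (3.9) p.271] [cite: Balaban1985Variational, (190) p.308, (115) p.294] -/
theorem ineq39_sectG_presentation (R : Regime 𝒢 0 W B₀ θ C₄ a₃ j a ε₄) (hWa : AnalyticOnNhd ℂ W {Y : 𝒴 | ‖Y‖ < a₃})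
    {Bt : 𝒳} (hJ : ‖D2 (H₀ Bt)‖ < j) (h𝔄 : ‖H₀ Bt‖ < a) {D : 𝒴 → 𝒳} {𝔇 : 𝒴 →L[ℂ] 𝒳} (H : 𝒳 →L[ℂ] 𝒴)
    (hD : HasFDerivAt D 𝔇 (solA180 𝒢 W D2 H₀ ε₄ Bt + H₀ Bt))
    {bB : BlockNorm g 𝒳} {bN : BlockNorm g 𝒴} {b3 : BlockNorm g 𝒵} {b₃ : BlockNorm g F₃}
    (hN : ∀ (y : g.Site) (v : 𝒴), bN.loc y v ≤ ‖v‖) (hBloc : ∀ (y' : g.Site) (μ : 𝒳), bB.IsLoc y' μ → ‖μ‖ ≤ bB.loc y' μ)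
    (Pr : 𝒴 →ₗ[ℝ] F₃) (hPr : ∀ (y : g.Site) (v : 𝒴), b₃.loc y (Pr v) ≤ bN.loc y v)
    {δ₀ BG θW cΔ A₀ AH θD c σ : ℝ}
    (htri : Triangle254 g) (hd : ∀ a b : g.Site, 0 ≤ g.dist a b) (hδ₀ : 0 ≤ δ₀) (hrow : RowSum g σ c)
    (hBG : 0 ≤ BG) (hθW : 0 ≤ θW) (hcΔ : 0 ≤ cΔ) (hA₀ : 0 ≤ A₀) (hAH : 0 ≤ AH) (hθD : 0 ≤ θD)
    (hG : HasMaj b3 bN (𝒢.restrictScalars ℝ : 𝒵 →ₗ[ℝ] 𝒴) (fun y y' => BG * Real.exp (-(δ₀ * g.dist y y'))))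
    (h189 : Ineq189 bN b3 ((fderiv ℂ W (solA180 𝒢 W D2 H₀ ε₄ Bt + H₀ Bt)).restrictScalars ℝ : 𝒴 →ₗ[ℝ] 𝒵) θW δ₀)
    (hD2H0 : HasMaj bB b3 ((D2 ∘L H₀).restrictScalars ℝ : 𝒳 →ₗ[ℝ] 𝒵) (fun y y' => cΔ * Real.exp (-(δ₀ * g.dist y y'))))
    (hH0 : HasMaj bB bN (H₀.restrictScalars ℝ : 𝒳 →ₗ[ℝ] 𝒴) (fun y y' => A₀ * Real.exp (-(δ₀ * g.dist y y'))))
    (hH : HasMaj bB bN (H.restrictScalars ℝ : 𝒳 →ₗ[ℝ] 𝒴) (fun y y' => AH * Real.exp (-(δ₀ / 2 * g.dist y y'))))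
    (hDfr : HasMaj bN bB (𝔇.restrictScalars ℝ : 𝒴 →ₗ[ℝ] 𝒳) (fun y y' => θD * Real.exp (-(δ₀ / 2 * g.dist y y'))))
    (hq : qG b3.κ bN.κ BG θW c < 1)
    (P : Data39) (hτ : 0 ≤ P.δ₀) (hστ : σ + P.δ₀ ≤ δ₀ / 8)
    (hB₃ : P.B₃ = const190 bB.κ bN.κ b3.κ BG θW cΔ A₀ AH θD c * bB.κ * c)
    (δB : 𝒳) (hm : ∀ y', bB.loc y' δB ≤ 2 * P.Ljη * P.normZH) (X : Set g.Site)
    (hloc : ∀ y ∈ X, ∀ y', bB.loc y' δB ≠ 0 → P.distX ≤ g.dist y y') (hcase : P.Minv ≤ P.distX)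
    {y : g.Site} (hy : y ∈ X)
    (hlhs : P.lhs = b₃.loc y (Pr (fderiv ℂ (chartH179 𝒢 W D2 H₀ (fun Y : 𝒴 => Y - H (D Y)) ε₄) Bt δB))) :
    Ineq39Printed P := by
  have hc : 0 ≤ c := hrow.nonneg y
  have hσ : σ ≤ δ₀ / 8 := by linarith
  have h190 := ineq190_sectG R hWa hJ h𝔄 H hD hN hBloc htri hd hδ₀ (hrow.mono hd hσ) hc hBG hθW hcΔ hA₀ hAH hθD hG
    h189 hD2H0 hH0 hH hDfr hq
  have h190' := ineq190_postcomp_of_loc_le Pr hPr h190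
  exact ineq39_of_ineq190 P h190'
    (const190_nonneg' bB.κ_nonneg bN.κ_nonneg b3.κ_nonneg hc hBG hθW hcΔ hA₀ hAH hθD hq)
    hd hrow hτ hστ hB₃ δB hm X hloc hcase hy (by simpa using hlhs)

variable {X : Type} {E : Type} [NormedAddCommGroup E] [NormedSpace ℝ E] {box : g.Site → Finset X} {blk : X → g.Site}

/-- **(3.9) FOR THE LATTICE FUNCTION `x ↦ (δ𝐇_j)(x)`, sup size.**  The special case of `ineq39_sectG_presentation` for the lattice
presentation `x ↦ ev x` into `X → E` (real CLMs reading off the values at the lattice point `x`; compatibility letter `hev`: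
`x ∈ box y → ‖ev x v‖ ≤ bN.loc y v`, print's (115)/(190) sizes being weighted sup norms *«for x ∈ Δ(y)»*) and r11's sup size
`supSize g box blk`: (3.9) with `P.lhs = sup_{x ∈ box y} ‖(δ𝐇_j)(x)‖` — the literal *«|δ𝐇_j| ≤ … on X»* at the block `y ∈ X`.
[cite: Balaban1987RG1, (3.9) p.271] [cite: Balaban1985Variational, (190) p.308, (115) p.294] -/
theorem ineq39_sectG_supSize (R : Regime 𝒢 0 W B₀ θ C₄ a₃ j a ε₄) (hWa : AnalyticOnNhd ℂ W {Y : 𝒴 | ‖Y‖ < a₃})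
    {Bt : 𝒳} (hJ : ‖D2 (H₀ Bt)‖ < j) (h𝔄 : ‖H₀ Bt‖ < a) {D : 𝒴 → 𝒳} {𝔇 : 𝒴 →L[ℂ] 𝒳} (H : 𝒳 →L[ℂ] 𝒴)
    (hD : HasFDerivAt D 𝔇 (solA180 𝒢 W D2 H₀ ε₄ Bt + H₀ Bt))
    {bB : BlockNorm g 𝒳} {bN : BlockNorm g 𝒴} {b3 : BlockNorm g 𝒵}
    (hN : ∀ (y : g.Site) (v : 𝒴), bN.loc y v ≤ ‖v‖) (hBloc : ∀ (y' : g.Site) (μ : 𝒳), bB.IsLoc y' μ → ‖μ‖ ≤ bB.loc y' μ)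
    (ev : X → (𝒴 →L[ℝ] E)) (hev : ∀ (y : g.Site) (v : 𝒴), ∀ x ∈ box y, ‖ev x v‖ ≤ bN.loc y v)
    {δ₀ BG θW cΔ A₀ AH θD c σ : ℝ}
    (htri : Triangle254 g) (hd : ∀ a b : g.Site, 0 ≤ g.dist a b) (hδ₀ : 0 ≤ δ₀) (hrow : RowSum g σ c)
    (hBG : 0 ≤ BG) (hθW : 0 ≤ θW) (hcΔ : 0 ≤ cΔ) (hA₀ : 0 ≤ A₀) (hAH : 0 ≤ AH) (hθD : 0 ≤ θD)
    (hG : HasMaj b3 bN (𝒢.restrictScalars ℝ : 𝒵 →ₗ[ℝ] 𝒴) (fun y y' => BG * Real.exp (-(δ₀ * g.dist y y'))))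
    (h189 : Ineq189 bN b3 ((fderiv ℂ W (solA180 𝒢 W D2 H₀ ε₄ Bt + H₀ Bt)).restrictScalars ℝ : 𝒴 →ₗ[ℝ] 𝒵) θW δ₀)
    (hD2H0 : HasMaj bB b3 ((D2 ∘L H₀).restrictScalars ℝ : 𝒳 →ₗ[ℝ] 𝒵) (fun y y' => cΔ * Real.exp (-(δ₀ * g.dist y y'))))
    (hH0 : HasMaj bB bN (H₀.restrictScalars ℝ : 𝒳 →ₗ[ℝ] 𝒴) (fun y y' => A₀ * Real.exp (-(δ₀ * g.dist y y'))))
    (hH : HasMaj bB bN (H.restrictScalars ℝ : 𝒳 →ₗ[ℝ] 𝒴) (fun y y' => AH * Real.exp (-(δ₀ / 2 * g.dist y y'))))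
    (hDfr : HasMaj bN bB (𝔇.restrictScalars ℝ : 𝒴 →ₗ[ℝ] 𝒳) (fun y y' => θD * Real.exp (-(δ₀ / 2 * g.dist y y'))))
    (hq : qG b3.κ bN.κ BG θW c < 1)
    (P : Data39) (hτ : 0 ≤ P.δ₀) (hστ : σ + P.δ₀ ≤ δ₀ / 8)
    (hB₃ : P.B₃ = const190 bB.κ bN.κ b3.κ BG θW cΔ A₀ AH θD c * bB.κ * c)
    (δB : 𝒳) (hm : ∀ y', bB.loc y' δB ≤ 2 * P.Ljη * P.normZH) (Xs : Set g.Site)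
    (hloc : ∀ y ∈ Xs, ∀ y', bB.loc y' δB ≠ 0 → P.distX ≤ g.dist y y') (hcase : P.Minv ≤ P.distX)
    {y : g.Site} (hy : y ∈ Xs)
    (hlhs : P.lhs = (supSize g box blk : BlockNorm g (X → E)).loc y
      (fun x => ev x (fderiv ℂ (chartH179 𝒢 W D2 H₀ (fun Y : 𝒴 => Y - H (D Y)) ε₄) Bt δB))) :
    Ineq39Printed P :=
  ineq39_sectG_presentation R hWa hJ h𝔄 H hD hN hBloc
    (LinearMap.pi fun x => ((ev x : 𝒴 →L[ℝ] E) : 𝒴 →ₗ[ℝ] E))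
    (fun y' v => supSize_loc_pi_le' (fun x => ((ev x : 𝒴 →L[ℝ] E) : 𝒴 →ₗ[ℝ] E)) hev y' v)
    htri hd hδ₀ hrow hBG hθW hcΔ hA₀ hAH hθD hG h189 hD2H0 hH0 hH hDfr hq P hτ hστ hB₃ δB hm Xs hloc hcase hy
    (hlhs.trans rfl)

end Presentation

end Literature.MathematicalPhysics.QuantumFieldTheory.Balaban1983to89.B12Ineq39From190

end
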